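import Literature.MathematicalPhysics.QuantumFieldTheory.Balaban1983to89.Node00.CarriersB12Chart
import Literature.MathematicalPhysics.QuantumFieldTheory.Balaban1983to89.B11Claim309UAnalytic

/-!
# NODE N09 [B12] — THE ANALYTICITY OF THE LEMMA-4 LETTERS `𝐊`, `𝐀₂` AT THE CHART PIN: the by-reference fields `hKan` ∕ `hA2an` of
# `Node00.ChartB12Inputs` DISCHARGED from [15] Prop. 9 «𝓗 is an analytic function of B» (lit-balaban r08's `B11Claim309UAnalytic`, BY NAME),
# the analyticity of `W`, `T` on their balls and ONE displayed law «the coarse datum `B` of (3.30) is analytic along analytic families»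

WIDTH SEAT `pub-ymgap-dag-n09-w1` (g0, 2026-08-27; HUMAN RULING D-0149 ∕ director-ym №197 work-bound push; plan g77 `W-SEAT-START-LIST.md` v2 §n09
ITEM 1 «`h09` outright at the record: instantiate the by-reference package fields at the objects, one field per file»; key K1⁷
`stmt-QuantumFields-20542`, `--supports`, COUNT-NEUTRAL helper).  APPEND-ONLY GROWTH: a NEW importing module; node00-def-B12's MODULE D
`Node00/CarriersB12Chart` (p479338: `ChartB12Run`, `ChartB12Laws`, `ChartB12Inputs`, `leaf_of_chart`) and lit-balaban r08's `B11Claim309UAnalytic`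
(`analyticOnNhd_chartH`) are CONSUMED BY NAME; nothing landed is edited or retyped.

PRINT.  [I] = T. Bałaban, *Renormalization group approach to lattice gauge field theories. I*, CMP **109** (1987) 249–301, Lemma 4 (3.53) p. 280:
*«The functions in (3.53) are analytic on the above spaces»*; p. 276: *«these gauge transformations are explicitly given analytic functions of 𝐔»*
(the coarse datum `B = (1/iη) log [exp iηA · exp(iL⁻¹η𝐇_{k+1}(□₀, (1/i) log V))]` of (3.30) is a composite of them); (3.37) p. 277 and (3.50)
pp. 279–280 (the letters `𝐊 = 𝐇_j(□₀, τQ(…))`, `𝐀₂`).  [15] = T. Bałaban, *The variational problem and background fields …*, CMP **102** (1985) 277–309: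
Prop. 4 p. 292 *«The functional derivative of V(A′) is an analytic function on this space»* (`W`); Sect. C (47) p. 287 (the map `T : A′ ↦ A′ − HD(A′)`,
analytic); Prop. 6 p. 296 *«the solution is an analytic function of 𝔄»*; Prop. 9 p. 309 *«The function 𝓗(B) … is an analytic function of B»*.

WHAT IS PROVED (kernel, sorry-free, theorems only).
§1 `analyticAt_chartH_datum` — THE [15] CHART (174) `𝔄 ↦ 𝓗(𝔄) = T(𝒜(𝔄) + 𝔄)` IS (FRÉCHET-)ANALYTIC AT EVERY DATUM `‖𝔄‖ < a` under a contraction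
   `Regime 𝒢 0 W …` with `W` analytic on `‖Y‖ < a₃` and `T` analytic on `‖Y‖ < ε₄ + a`: r08's `B11Claim309UAnalytic.analyticOnNhd_chartH` with the
   datum itself as the parameter (`𝒰 := 𝒴`, `𝒪 := {‖𝔄‖ < a}`, the other data constant) — a one-line specialisation, not a re-proof.
§2 AT A CHARTED RUN `χ : ChartB12Run P N M 𝒴 𝒵` of NODE 00's [B12] layer under its chart laws `ChartB12Laws Rz cB χ`:
   `analyticAt_ev_apply` (each bond coordinate `Y ↦ ev Y b` of the norm-dominated presentation is analytic — a CLM by `laws.ev_le`),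
   `analyticAt_dat` (`𝔄 = H_{1,j}B` is analytic along a family along which `B` is), **`hKan_of_chart`** and **`hA2an_of_chart`** — EXACTLY the
   binder texts of the fields `ChartB12Inputs.hKan` ∕ `.hA2an` (module D :480–492), concluded from the laws, (ii) `W`∕`T` analytic on their
   balls, (iii) the datum law; `leaf_of_chart_of_analytic` — module D's `ChartB12Inputs.leaf_of_chart` (hence module C ∕ dag-n09-c's closer ∕
   p07's `lemma4Printed_frameOf`) with the two analyticity fields SUPPLIED: LEMMA 4 (3.53) `B12LeafOfRecord Rz cB χ.toResid` from «X ⊂ □̃²», the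
   seven restrictions, the by-reference residue `inputsRef` ([15]∕[14]∕[12] statements: N07∕N04 in-edges), the chart laws, (ii), (iii) and `0 < cB`.
§3 `exists_chartB12Laws_analytic` — A6 witness: the hypotheses kept by §2 (laws + (ii) + (iii)) hold jointly at module D's zero scheme.
§4 `lemma4Printed_F12OfRecord₁₂_of_chart_of_analytic` — AT def-T's STAGE 12 ∕ 13 OBJECTS: the binder text `B12Sec2to5.Lemma4Printed (F12OfRecord₁₂ F N θ lam12 P)
   (lam12 P).consts` of the K1⁷ four-pin engines ∕ doors (dag-n12-d `…N12AtRecord13SepCoPHSockets` :116, dag-n24-c `N24ItemsStage13AtThm1CCMW…`, their `h09`)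
   for a CHARTED family `lam12 := fun q => (χ q).toResid` (`θ := θ₁₃.toStage12Params`), from the run's §2 hypotheses and Stage-12 admissibility.

HONEST SCOPE ∕ A6 (№189).  (a) What moved: two of the by-reference hypothesis FIELDS of N09's conjunct-1 road (`hKan`, `hA2an`: statements
quantified over all analytic families in arbitrary complex normed parameter spaces) are now THEOREMS at the chart pin; what replaces them is
PRINT-SHAPED — the analyticity of `W` ([15] Prop. 4), of `T` ([15] (47)) and of the residual coarse datum `B` ([I] p. 276): three sentences print
states about its own objects, in the currency of the chart laws (`regime.quad` already carries the line-analytic form of the first).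
(b) What did NOT move: the `JInputsRef` residue (upper-space datum (3.40), gauge transformations ∕ costs (3.26)(3.37)(3.39)(3.42), identities
(3.38)×2, (J2)×2, (J3)), the 13 datum-free chart laws and the two datum-size laws remain hypotheses displayed by name; N09 is NOT discharged;
counts unmoved (typed 28∕28 · discharged 5∕27).  (c) Satisfiability: the hypotheses KEPT by `hKan_of_chart` ∕ `hA2an_of_chart` (chart laws + analyticity of `W`, `T` + the datum law)
are JOINTLY SATISFIABLE — PROVED in §3 (`exists_chartB12Laws_analytic`) at module D's zero scheme (`𝒢 = 0`, `W = 0`, `T = id`, `ev = 0`, `lin = 0`,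
`B = 0`): a sanity witness only, physically vacuous, NOT the objects of record (those are N07's [15] scheme and the (3.26)–(3.30) composite); the
further binders of `leaf_of_chart_of_analytic` ∕ §4 (hX, the seven restrictions, `inputsRef`) are module C∕D's displayed package, unchanged, whose
joint inhabitation with the laws is NOT witnessed here (restrictions alone: dag-n09-c's `exists_residB12Run_restrictions`).
(d) Model: `𝒴`, `𝒵` complete (automatic on the finite lattice, r08 (M4)).  One finite 𝕋⁴ programme at fixed `ε = L^{−K}`, Bałaban AS PRINTED;
the Yang–Mills mass gap (Clay) is NOT proved by any of this — R4 closes the conditional finite-𝕋⁴ rung `BalabanLadder.UV` only; nothing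
continuum ∕ ℝ⁴ ∕ infinite volume ∕ OS ∕ mass gap ∕ Clay.  No `sorry`, no `axiom`, no `def`, no `instance`, no `notation`.
-/

noncomputable section

namespace Summit.QuantumFields.YangMills.BalabanUVNodes.N09ChartLettersAnalytic

open Metric Set Filter Topology
open Literature.MathematicalPhysics.QuantumFieldTheory.Balaban1983to89
open Literature.MathematicalPhysics.QuantumFieldTheory.Balaban1983to89.Node00
open B12RegularSpaces111 (space)
open B12RegularSpaces111SpecialUnitary (suModel)
open B12Lemma4ConcreteFrame (LettersAnalyticAt)
open B11Eq174Chart (Regime chartH)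
open B11Claim309UAnalytic (analyticOnNhd_chartH)
open Literature.MathematicalPhysics.QuantumFieldTheory.Balaban1983to89.T4Continuum (T4Family)
open scoped Matrix.Norms.L2Operator

/-! ## §1. [15] Prop. 9: the chart (174) is an analytic function of its datum (Fréchet form; r08's theorem with the datum as the parameter) -/

section Chart

variable {𝒴 𝒵 : Type*} [NormedAddCommGroup 𝒴] [NormedSpace ℂ 𝒴] [NormedAddCommGroup 𝒵] [NormedSpace ℂ 𝒵]
  [CompleteSpace 𝒴] [CompleteSpace 𝒵]
  {𝒢 : 𝒵 →L[ℂ] 𝒴} {W : 𝒴 → 𝒵} {T : 𝒴 → 𝒴} {B₀ θ C₄ a₃ j a ε₄ : ℝ}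

/-- **[15] Prop. 9 «The function 𝓗(B) … is an analytic function of B», FRÉCHET FORM IN THE DATUM**: under a contraction regime for `(𝒢, 0, W)`
((117)–(121)) with `W = (δ/δA′)V` analytic on `‖Y‖ < a₃` (Prop. 4) and the Sect. C map `T` analytic on `‖Y‖ < ε₄ + a` ((47)), the chart
`𝔄 ↦ 𝓗(𝔄) = T(𝒜(𝔄) + 𝔄)` ((174)–(175), `J = 0`) is analytic at every datum `‖𝔄‖ < a` — lit-balaban r08's `B11Claim309UAnalytic.analyticOnNhd_chartH`
(analytic dependence of the contracting fixed point on a Banach parameter, by the analytic implicit function theorem) with the datum itself as the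
parameter. [cite: Balaban1985Variational, Prop. 9 p.309, Prop. 6 p.296, (174)-(175) p.305, Prop. 4 p.292, (47) p.287] -/
theorem analyticAt_chartH_datum (R : Regime 𝒢 0 W B₀ θ C₄ a₃ j a ε₄) (hj : 0 ≤ j)
    (hWa : AnalyticOnNhd ℂ W {Y : 𝒴 | ‖Y‖ < a₃}) (hTa : AnalyticOnNhd ℂ T {Y : 𝒴 | ‖Y‖ < ε₄ + a})
    {𝔄₀ : 𝒴} (h𝔄₀ : ‖𝔄₀‖ < a) : AnalyticAt ℂ (chartH 𝒢 0 W 0 T ε₄) 𝔄₀ := by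
  have h𝒪 : IsOpen {𝔄 : 𝒴 | ‖𝔄‖ < a} := isOpen_lt continuous_norm continuous_const
  have hW2 : AnalyticOnNhd ℂ (fun p : 𝒴 × 𝒴 => W p.2) ({𝔄 : 𝒴 | ‖𝔄‖ < a} ×ˢ {Y : 𝒴 | ‖Y‖ < a₃}) :=
    fun p hp => (hWa p.2 (mem_prod.mp hp).2).comp analyticAt_snd
  have hT2 : AnalyticOnNhd ℂ (fun p : 𝒴 × 𝒴 => T p.2) ({𝔄 : 𝒴 | ‖𝔄‖ < a} ×ˢ {Y : 𝒴 | ‖Y‖ < ε₄ + a}) :=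
    fun p hp => (hTa p.2 (mem_prod.mp hp).2).comp analyticAt_snd
  have hJb : ∀ 𝔄 ∈ {𝔄 : 𝒴 | ‖𝔄‖ < a}, ‖(0 : 𝒵)‖ ≤ j := fun _ _ => by simpa using hj
  exact analyticOnNhd_chartH (𝒢 := fun _ : 𝒴 => 𝒢) (Λ := fun _ : 𝒴 => (0 : 𝒴 →L[ℂ] 𝒴)) (W := fun _ : 𝒴 => W)
    (J := fun _ : 𝒴 => (0 : 𝒵)) (𝔄 := fun 𝔄 : 𝒴 => 𝔄) (Tm := fun _ : 𝒴 => T) h𝒪 (fun _ _ => R) hJb (fun _ h => h)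
    analyticOnNhd_const analyticOnNhd_const hW2 analyticOnNhd_const analyticOnNhd_id hT2 𝔄₀ h𝔄₀

end Chart

/-! ## §2. At a charted run of NODE 00's [B12] layer: `hKan`, `hA2an` discharged; Lemma 4 at the group of record without the analyticity fields -/

section Pin

variable {P : Params} {N M : ℕ} {𝒴 𝒵 : Type} [NormedAddCommGroup 𝒴] [NormedSpace ℂ 𝒴] [NormedAddCommGroup 𝒵] [NormedSpace ℂ 𝒵]
  {Rz : Sect2.Residual P (MatA N)} {cB : ℝ} {χ : ChartB12Run P N M 𝒴 𝒵}

/-- Each bond coordinate `Y ↦ (ev Y)(b)` of a presentation dominated by the norm (`laws.ev_le`: `‖ev Y b‖ ≤ ‖Y‖`) is a continuous linear map, hence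
analytic (the (115)-space read on the bonds of `T_ξ`). [cite: Balaban1985Variational, (115) p.295] [cite: Balaban1987RG1, (3.37) p.277] -/
theorem analyticAt_ev_apply (laws : ChartB12Laws Rz cB χ) (b : PBond P 0) (Y₀ : 𝒴) : AnalyticAt ℂ (fun Y : 𝒴 => χ.ev Y b) Y₀ := by
  let L : 𝒴 →L[ℂ] MatA N := ((LinearMap.proj b).comp χ.ev).mkContinuous 1 (fun Y => by simpa using laws.ev_le Y b)
  have hL : (fun Y : 𝒴 => χ.ev Y b) = L := by funext Y; rfl
  rw [hL]
  exact L.analyticAt Y₀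

/-- **The datum `𝔄 = H_{1,j}B` is analytic along every family along which the coarse datum `B` of (3.30) is** (`H_{1,j}` a continuous linear
datum). [cite: Balaban1987RG1, (3.30) p.276, p.279] [cite: Balaban1985Variational, (103) p.293] -/
theorem analyticAt_dat {E : Type} [NormedAddCommGroup E] [NormedSpace ℂ E] {Φf : E → FieldPair P 0 (MatA N)ˣ (MatA N)}
    {Af : E → PBond P 0 → MatA N} {e₀ : E} (hB : AnalyticAt ℂ (fun e => χ.fldB (Φf e) (Af e)) e₀) :
    AnalyticAt ℂ (fun e => χ.dat (Φf e) (Af e)) e₀ :=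
  (χ.lin.analyticAt _).fun_comp hB

variable [CompleteSpace 𝒴] [CompleteSpace 𝒵]

/-- **`hKan` DISCHARGED AT THE CHART PIN** — the analyticity of the letters of the pinned `𝐊 = ev 𝓗(τ𝔄)` ((3.37)) along every analytic family of the
variables with values in the printed domain (EXACTLY the binder text of `ChartB12Inputs.hKan`): from the chart laws (the regime; `ev` norm-dominated;
`‖τ𝔄‖ < a` on the domain), the analyticity of `W` on `‖Y‖ < a₃` ([15] Prop. 4) and of `T` on `‖Y‖ < ε₄ + a` ([15] (47)), and the analyticity of
the coarse datum `B` of (3.30) along analytic families on the domain ([I] p. 276 «explicitly given analytic functions of 𝐔»): the composite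
`e ↦ ev(𝓗(τ·H_{1,j}B(e)))(b)` of analytic maps (§1). [cite: Balaban1987RG1, Lemma 4 p.280 («The functions in (3.53) are analytic»), (3.37) p.277, p.276]
[cite: Balaban1985Variational, Prop. 9 p.309] -/
theorem hKan_of_chart (laws : ChartB12Laws Rz cB χ)
    (hWa : AnalyticOnNhd ℂ χ.W {Y : 𝒴 | ‖Y‖ < χ.a₃}) (hTa : AnalyticOnNhd ℂ χ.T {Y : 𝒴 | ‖Y‖ < χ.ε₄ + χ.a})
    (hBan : ∀ {E : Type} [NormedAddCommGroup E] [NormedSpace ℂ E] {Φf : E → FieldPair P 0 (MatA N)ˣ (MatA N)}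
      {Af Bf : E → PBond P 0 → MatA N} {e₀ : E}, LettersAnalyticAt Φf Af Bf e₀ →
        Φf e₀ ∈ space (suModel N) (χ.toResid.frameBox Rz) (χ.toResid.csBox cB) ((1 + 2 * χ.toResid.consts.β) * χ.toResid.consts.α₀)
            ((1 + 2 * χ.toResid.consts.β) * χ.toResid.consts.α₁) χ.toResid.α₀ →
          Af e₀ ∈ χ.toResid.A331 → AnalyticAt ℂ (fun e => χ.fldB (Φf e) (Af e)) e₀)
    {E : Type} [NormedAddCommGroup E] [NormedSpace ℂ E] {Φf : E → FieldPair P 0 (MatA N)ˣ (MatA N)}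
    {Af Bf : E → PBond P 0 → MatA N} {e₀ : E} (τ : ℝ) (hLe : LettersAnalyticAt Φf Af Bf e₀)
    (hΦ : Φf e₀ ∈ space (suModel N) (χ.toResid.frameBox Rz) (χ.toResid.csBox cB) ((1 + 2 * χ.toResid.consts.β) * χ.toResid.consts.α₀)
      ((1 + 2 * χ.toResid.consts.β) * χ.toResid.consts.α₁) χ.toResid.α₀)
    (hA : Af e₀ ∈ χ.toResid.A331) (hτ0 : 0 ≤ τ) (hτ1 : τ ≤ 1) (_hB' : ‖Bf e₀‖ < χ.toResid.consts.α₃) (b : PBond P 0) :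
    AnalyticAt ℂ (fun e => χ.K (Φf e) (Af e) τ b) e₀ := by
  have hdat : AnalyticAt ℂ (fun e => (τ : ℂ) • χ.dat (Φf e) (Af e)) e₀ := (analyticAt_dat (hBan hLe hΦ hA)).const_smul
  have hpt : ‖(τ : ℂ) • χ.dat (Φf e₀) (Af e₀)‖ < χ.a := laws.norm_smul_dat_lt hΦ hA hτ0 hτ1
  have hch : AnalyticAt ℂ (chartH χ.𝒢 0 χ.W 0 χ.T χ.ε₄) ((τ : ℂ) • χ.dat (Φf e₀) (Af e₀)) :=
    analyticAt_chartH_datum laws.regime laws.jc_nonneg hWa hTa hpt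
  have hcomp : AnalyticAt ℂ (fun e => chartH χ.𝒢 0 χ.W 0 χ.T χ.ε₄ ((τ : ℂ) • χ.dat (Φf e) (Af e))) e₀ :=
    AnalyticAt.fun_comp (f := fun e => (τ : ℂ) • χ.dat (Φf e) (Af e)) (x := e₀) hch hdat
  show AnalyticAt ℂ (fun e => χ.ev (chartH χ.𝒢 0 χ.W 0 χ.T χ.ε₄ ((τ : ℂ) • χ.dat (Φf e) (Af e))) b) e₀
  exact (analyticAt_ev_apply laws b _).fun_comp hcomp

/-- **`hA2an` DISCHARGED AT THE CHART PIN** — the analyticity of the letters of the pinned increment `𝐀₂ = ev(𝓗(τ𝔄 + H_{1,j}B′) − 𝓗(τ𝔄))` ((3.50))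
along every analytic family of the variables with values in the printed domain (EXACTLY the binder text of `ChartB12Inputs.hA2an`): as `hKan_of_chart`,
with `‖τ𝔄 + H_{1,j}B′‖ < a` (`laws.dat_lin_lt`) and `B′ ↦ H_{1,j}B′` continuous linear. [cite: Balaban1987RG1, Lemma 4 p.280, (3.50) pp.279-280, p.276]
[cite: Balaban1985Variational, Prop. 9 p.309] -/
theorem hA2an_of_chart (laws : ChartB12Laws Rz cB χ)
    (hWa : AnalyticOnNhd ℂ χ.W {Y : 𝒴 | ‖Y‖ < χ.a₃}) (hTa : AnalyticOnNhd ℂ χ.T {Y : 𝒴 | ‖Y‖ < χ.ε₄ + χ.a})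
    (hBan : ∀ {E : Type} [NormedAddCommGroup E] [NormedSpace ℂ E] {Φf : E → FieldPair P 0 (MatA N)ˣ (MatA N)}
      {Af Bf : E → PBond P 0 → MatA N} {e₀ : E}, LettersAnalyticAt Φf Af Bf e₀ →
        Φf e₀ ∈ space (suModel N) (χ.toResid.frameBox Rz) (χ.toResid.csBox cB) ((1 + 2 * χ.toResid.consts.β) * χ.toResid.consts.α₀)
            ((1 + 2 * χ.toResid.consts.β) * χ.toResid.consts.α₁) χ.toResid.α₀ →
          Af e₀ ∈ χ.toResid.A331 → AnalyticAt ℂ (fun e => χ.fldB (Φf e) (Af e)) e₀)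
    {E : Type} [NormedAddCommGroup E] [NormedSpace ℂ E] {Φf : E → FieldPair P 0 (MatA N)ˣ (MatA N)}
    {Af Bf : E → PBond P 0 → MatA N} {e₀ : E} (τ : ℝ) (hLe : LettersAnalyticAt Φf Af Bf e₀)
    (hΦ : Φf e₀ ∈ space (suModel N) (χ.toResid.frameBox Rz) (χ.toResid.csBox cB) ((1 + 2 * χ.toResid.consts.β) * χ.toResid.consts.α₀)
      ((1 + 2 * χ.toResid.consts.β) * χ.toResid.consts.α₁) χ.toResid.α₀)
    (hA : Af e₀ ∈ χ.toResid.A331) (hτ0 : 0 ≤ τ) (hτ1 : τ ≤ 1) (hB' : ‖Bf e₀‖ < χ.toResid.consts.α₃) (b : PBond P 0) :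
    AnalyticAt ℂ (fun e => χ.A₂ (Φf e) (Af e) τ (Bf e) b) e₀ := by
  have hdat : AnalyticAt ℂ (fun e => (τ : ℂ) • χ.dat (Φf e) (Af e)) e₀ := (analyticAt_dat (hBan hLe hΦ hA)).const_smul
  have hBf : AnalyticAt ℂ (fun e => Bf e) e₀ := AnalyticAt.pi hLe.2.2.2
  have hlin : AnalyticAt ℂ (fun e => χ.lin (Bf e)) e₀ := (χ.lin.analyticAt _).fun_comp hBf
  have hsum : AnalyticAt ℂ (fun e => (τ : ℂ) • χ.dat (Φf e) (Af e) + χ.lin (Bf e)) e₀ := hdat.add hlin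
  have hpt₀ : ‖(τ : ℂ) • χ.dat (Φf e₀) (Af e₀)‖ < χ.a := laws.norm_smul_dat_lt hΦ hA hτ0 hτ1
  have hpt₁ : ‖(τ : ℂ) • χ.dat (Φf e₀) (Af e₀) + χ.lin (Bf e₀)‖ < χ.a := laws.dat_lin_lt _ _ τ _ hΦ hA hτ0 hτ1 hB'
  have hch₀ : AnalyticAt ℂ (fun e => chartH χ.𝒢 0 χ.W 0 χ.T χ.ε₄ ((τ : ℂ) • χ.dat (Φf e) (Af e))) e₀ :=
    AnalyticAt.fun_comp (f := fun e => (τ : ℂ) • χ.dat (Φf e) (Af e)) (x := e₀)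
      (analyticAt_chartH_datum laws.regime laws.jc_nonneg hWa hTa hpt₀) hdat
  have hch₁ : AnalyticAt ℂ (fun e => chartH χ.𝒢 0 χ.W 0 χ.T χ.ε₄ ((τ : ℂ) • χ.dat (Φf e) (Af e) + χ.lin (Bf e))) e₀ :=
    AnalyticAt.fun_comp (f := fun e => (τ : ℂ) • χ.dat (Φf e) (Af e) + χ.lin (Bf e)) (x := e₀)
      (analyticAt_chartH_datum laws.regime laws.jc_nonneg hWa hTa hpt₁) hsum
  show AnalyticAt ℂ (fun e => χ.ev (chartH χ.𝒢 0 χ.W 0 χ.T χ.ε₄ ((τ : ℂ) • χ.dat (Φf e) (Af e) + χ.lin (Bf e)) -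
    chartH χ.𝒢 0 χ.W 0 χ.T χ.ε₄ ((τ : ℂ) • χ.dat (Φf e) (Af e))) b) e₀
  exact (analyticAt_ev_apply laws b _).fun_comp (hch₁.sub hch₀)

/-- **LEMMA 4 (3.53) AT THE GROUP OF RECORD FROM A CHARTED RUN WITHOUT THE ANALYTICITY FIELDS** — module D's `ChartB12Inputs.leaf_of_chart` (= module C's
`B12FundamentalInputs.leaf` = dag-n09-c's closer = p07's `lemma4Printed_frameOf`, BY NAME) with `hKan` ∕ `hA2an` SUPPLIED by `hKan_of_chart` ∕
`hA2an_of_chart`: the `b12` leaf `B12LeafOfRecord Rz cB χ.toResid` from the fundamental case «X ⊂ □̃²», the seven restrictions of p07's `Lemma4Data`, the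
by-reference residue `inputsRef` ([15]∕[14]∕[12] statements at every value of the variables in the printed domain), the chart laws, the analyticity of
`W`, `T` on their balls, the datum law, and `0 < cB`.  NOT a discharge of N09: the residue, the laws and the two analyticity letters are hypotheses.
[cite: Balaban1987RG1, Lemma 4 (3.53) p.280 with (3.26)-(3.52) pp.275-280, p.273 («the fundamental case X ⊂ □̃²»)] [cite: Balaban1985Variational, Prop. 9 p.309] -/
theorem leaf_of_chart_of_analytic [NeZero N] (laws : ChartB12Laws Rz cB χ) (hX : χ.idx.XSites ⊆ χ.idx.boxT 2)
    (hB : 1 ≤ χ.toResid.consts.B₃) (hY : 1 ≤ χ.toResid.consts.B₃ ^ 2 * χ.toResid.consts.O₁ * χ.toResid.consts.M)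
    (hα₁ : 16 * (χ.toResid.consts.O₁ * χ.toResid.consts.M * χ.toResid.consts.α₁) ≤ χ.toResid.consts.β)
    (hL10 : 1 + 10 * χ.toResid.consts.β ≤ χ.toResid.consts.L ^ 2) (hB'' : 0 ≤ χ.toResid.B₃'')
    (hres'' : χ.toResid.B₃'' * χ.toResid.consts.α₃ ≤ χ.toResid.consts.β * χ.toResid.consts.L⁻¹ ^ 2 * χ.toResid.consts.α₀)
    (hresJ : 4 * ((P.d - 1) * ((2 : ℝ) * B12Eq311CurrentExpansion.C311 1)) * (χ.toResid.consts.B₃ ^ 2 * χ.toResid.consts.O₁ * χ.toResid.consts.M) ^ 2 *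
      χ.toResid.consts.α₀ ≤ χ.toResid.consts.β)
    (inputsRef : ∀ (Φ : FieldPair P 0 (MatA N)ˣ (MatA N)) (A : PBond P 0 → MatA N) (τ : ℝ) (B' : PBond P 0 → MatA N),
      Φ ∈ space (suModel N) (χ.toResid.frameBox Rz) (χ.toResid.csBox cB) ((1 + 2 * χ.toResid.consts.β) * χ.toResid.consts.α₀)
          ((1 + 2 * χ.toResid.consts.β) * χ.toResid.consts.α₁) χ.toResid.α₀ →
        A ∈ χ.toResid.A331 → 0 ≤ τ → τ ≤ 1 → ‖B'‖ < χ.toResid.consts.α₃ →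
          JInputsRef (suModel N) χ.toResid.consts (χ.toResid.frameX Rz) (χ.toResid.frameBox Rz) (χ.toResid.csX cB)
            (χ.toResid.csBox cB) χ.toResid.regionY (B12Lemma4Models.slProj N) χ.toResid.idx.η χ.toResid.B₃'' χ.toResid.α₀ χ.toResid.idx.j τ ‖B'‖
            (χ.K Φ A τ) (χ.A₂ Φ A τ B') (χ.H Φ A) (χ.H₁ Φ A))
    (hWa : AnalyticOnNhd ℂ χ.W {Y : 𝒴 | ‖Y‖ < χ.a₃}) (hTa : AnalyticOnNhd ℂ χ.T {Y : 𝒴 | ‖Y‖ < χ.ε₄ + χ.a})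
    (hBan : ∀ {E : Type} [NormedAddCommGroup E] [NormedSpace ℂ E] {Φf : E → FieldPair P 0 (MatA N)ˣ (MatA N)}
      {Af Bf : E → PBond P 0 → MatA N} {e₀ : E}, LettersAnalyticAt Φf Af Bf e₀ →
        Φf e₀ ∈ space (suModel N) (χ.toResid.frameBox Rz) (χ.toResid.csBox cB) ((1 + 2 * χ.toResid.consts.β) * χ.toResid.consts.α₀)
            ((1 + 2 * χ.toResid.consts.β) * χ.toResid.consts.α₁) χ.toResid.α₀ →
          Af e₀ ∈ χ.toResid.A331 → AnalyticAt ℂ (fun e => χ.fldB (Φf e) (Af e)) e₀)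
    (hcB : 0 < cB) : B12LeafOfRecord Rz cB χ.toResid :=
  ChartB12Inputs.leaf_of_chart
    { hX := hX, hB := hB, hY := hY, hα₁ := hα₁, hL10 := hL10, hB'' := hB'', hres'' := hres'', hresJ := hresJ, inputsRef := inputsRef,
      hKan := fun τ hLe hΦ hA hτ0 hτ1 hB' => hKan_of_chart laws hWa hTa hBan τ hLe hΦ hA hτ0 hτ1 hB',
      hA2an := fun τ hLe hΦ hA hτ0 hτ1 hB' => hA2an_of_chart laws hWa hTa hBan τ hLe hΦ hA hτ0 hτ1 hB' } laws hcB

end Pin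

/-! ## §3. A6 sanity witness: the hypotheses kept by §2 are jointly satisfiable (zero scheme; physically vacuous) -/

section Witness

variable {P : Params} {N M : ℕ} (𝒴 𝒵 : Type) [NormedAddCommGroup 𝒴] [NormedSpace ℂ 𝒴] [NormedAddCommGroup 𝒵] [NormedSpace ℂ 𝒵]

/-- **THE HYPOTHESES OF `hKan_of_chart` ∕ `hA2an_of_chart` ARE JOINTLY SATISFIABLE** (A6 sanity witness, physically VACUOUS): at module D's zero scheme
(`𝒢 = 0`, `W = 0`, `T = id`, `ev = 0`, `H_{1,j} = 0`, `B = 0`, `a = 1`, `Klip = 1`, `B₃ = α₀ = 1`, `O(1) = L`, `j = k = 1`, `0 < M` — the witness of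
`Node00.chartB12Laws_degenerate`, re-exhibited because that theorem's existential hides it) the chart laws hold AND `W`, `T` are analytic on their balls AND
the coarse datum is analytic along every family.  NOT the objects of record (those are N07's [15] scheme and the (3.26)–(3.30) composite).
[cite: Balaban1985Variational, Prop. 6 p.295 (bookkeeping)] [cite: Balaban1987RG1, (3.30) p.276 (bookkeeping)] -/
theorem exists_chartB12Laws_analytic (Rz : Sect2.Residual P (MatA N)) (cB : ℝ) (hM : 0 < M) :
    ∃ χ : ChartB12Run P N M 𝒴 𝒵, ChartB12Laws Rz cB χ ∧ AnalyticOnNhd ℂ χ.W {Y : 𝒴 | ‖Y‖ < χ.a₃} ∧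
      AnalyticOnNhd ℂ χ.T {Y : 𝒴 | ‖Y‖ < χ.ε₄ + χ.a} ∧
      ∀ {E : Type} [NormedAddCommGroup E] [NormedSpace ℂ E] {Φf : E → FieldPair P 0 (MatA N)ˣ (MatA N)}
        {Af Bf : E → PBond P 0 → MatA N} {e₀ : E}, LettersAnalyticAt Φf Af Bf e₀ →
          Φf e₀ ∈ space (suModel N) (χ.toResid.frameBox Rz) (χ.toResid.csBox cB) ((1 + 2 * χ.toResid.consts.β) * χ.toResid.consts.α₀)
              ((1 + 2 * χ.toResid.consts.β) * χ.toResid.consts.α₁) χ.toResid.α₀ →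
            Af e₀ ∈ χ.toResid.A331 → AnalyticAt ℂ (fun e => χ.fldB (Φf e) (Af e)) e₀ := by
  have hL : (0 : ℝ) < P.L := by exact_mod_cast lt_trans zero_lt_one P.hL.2
  have hMr : (0 : ℝ) < M := by exact_mod_cast hM
  refine
    ⟨{ idx := { k := 1, j := 1, one_le_j := le_rfl, j_le_k := le_rfl, cube := fun _ => 0, X := Sect2.cubeDom P M 1 fun _ => 0 },
       𝒢 := 0, W := fun _ => 0, T := fun Y => Y, ε₄ := 0, B₀ := 0, θ := 0, C₄ := 0, a₃ := 2, jc := 0, a := 1, Klip := 1, K_D := 0,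
       ev := 0, lin := 0, fldB := fun _ _ _ => 0, A331 := Set.univ,
       B₃ := 1, O₁ := P.L, β₀ := 0, β := 0, α₀ := 1, α₁ := 0, α₂ := 0, α₃ := 0, B₃'' := 0 }, ?_,
      analyticOnNhd_const, analyticOnNhd_id, fun _ _ _ => analyticAt_const⟩
  have hη : (P.L : ℝ) ^ (1 - 1) * P.eta 1 = (P.L : ℝ)⁻¹ := by simp [Params.eta]
  refine
    { regime :=
        { norm_G := fun f => by simp
          norm_L := fun Y => by simp
          quad := ⟨fun Y _ => by simp, fun _ _ => differentiableOn_const _⟩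
          B₀_nonneg := le_rfl
          C₄_nonneg := le_rfl
          θ_nonneg := le_rfl
          ε₄_nonneg := le_rfl
          dom := by norm_num
          self := by norm_num
          contr := by norm_num }
      jc_nonneg := le_rfl
      T_zero := rfl
      Klip_pos := one_pos
      lip := fun x y _ _ => by simp
      KD_nonneg := le_rfl
      second := fun Y _ => by simp
      ev_le := fun Y b => by simp
      grad_ev_le := fun Y μ ν y => by simp [B12RegularSpaces111.grad]
      ev_gc := fun Y b => by simp
      dat_lt := fun Φ A _ _ => by simp [ChartB12Run.dat]
      dat_lin_lt := fun Φ A τ B' _ _ _ _ _ => by simp [ChartB12Run.dat]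
      h337 := ?_
      h345 := ?_
      h350 := by
        show (1 : ℝ) * ((0 + 4 * 0 * 0 * (0 + 1)) / (1 - (0 + 4 * 0 * 0 * (0 + 1))) + 1) * ‖(0 : (PBond P 0 → MatA N) →L[ℂ] 𝒴)‖ ≤ 1
        rw [ContinuousLinearMap.opNorm_zero]
        norm_num }
  · show (1 : ℝ) * (0 + 1) ≤ (1 : ℝ) ^ 2 * (P.L : ℝ) * (M : ℝ) * 1 * ((P.L : ℝ) ^ (1 - 1) * P.eta 1)
    rw [hη]
    field_simp
    exact_mod_cast hM
  · show (2 : ℝ) * (0 + 0 * 0) * (0 + 1) ^ 2 < 1 * (1 * (P.L : ℝ) * (M : ℝ) * 1 * ((P.L : ℝ) ^ (1 - 1) * P.eta 1)) ^ 2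
    rw [hη]
    have h1 : (1 : ℝ) * (P.L : ℝ) * (M : ℝ) * 1 * (P.L : ℝ)⁻¹ = M := by field_simp
    rw [h1]
    nlinarith [pow_pos hMr 2]

end Witness

/-! ## §4. At def-T's STAGE 12 ∕ 13: the `h09` binder of the K1⁷ four-pin engines for a CHARTED family, without the analyticity fields -/

section Stage12

variable (F : T4Family) (N : ℕ) [NeZero N]

/-- **N09's ROW `h09` AT THE RECORD OBJECTS FOR A CHARTED [B12] FAMILY, WITHOUT THE ANALYTICITY FIELDS** — the binder
`B12Sec2to5.Lemma4Printed (F12OfRecord₁₂ F N θ lam12 P) (lam12 P).consts` of dag-n12-d's ∕ dag-n24-c's Stage-13 four-pin engines and doors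
(`…N12AtRecord13SepCoPHSockets`, `N24ItemsStage13AtThm1CCMW…` with `θ := θ₁₃.toStage12Params`) at the charted layer `lam12 := fun q => (χ q).toResid`,
run `P`: LEMMA 4 (3.53) [I] at the frame of record `F12OfRecord (θ.Rz P.K) θ.s2.cB (χ P).toResid` from the run's chart laws, «X ⊂ □̃²», the seven
restrictions, the by-reference residue `inputsRef`, the analyticity of `W`, `T` on their balls ([15] Prop. 4 ∕ (47)) and of the coarse datum `B` of (3.30)
along analytic families ([I] p. 276), and Stage-12 admissibility (`0 < O(1)LMB`).  = §2's `leaf_of_chart_of_analytic` (`B12LeafOfRecord₁₂` unfolds to it,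
def-T `Record12Carriers` :170–175).  NOT a discharge of N09; count-neutral.
[cite: Balaban1987RG1, Lemma 4 (3.53) p.280, p.273 («the fundamental case X ⊂ □̃²»), p.276] [cite: Balaban1985Variational, Prop. 9 p.309, Prop. 4 p.292] -/
theorem lemma4Printed_F12OfRecord₁₂_of_chart_of_analytic (θ : Stage12Params F N) (hθ : θ.Admissible F N)
    {𝒴 𝒵 : B12.RunParams → Type} [∀ q, NormedAddCommGroup (𝒴 q)] [∀ q, NormedSpace ℂ (𝒴 q)] [∀ q, CompleteSpace (𝒴 q)]
    [∀ q, NormedAddCommGroup (𝒵 q)] [∀ q, NormedSpace ℂ (𝒵 q)] [∀ q, CompleteSpace (𝒵 q)]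
    (χ : ∀ q : B12.RunParams, ChartB12Run (F.P q.K) N θ.τ9.M (𝒴 q) (𝒵 q)) (P : B12.RunParams)
    (laws : ChartB12Laws (θ.Rz P.K) θ.s2.cB (χ P)) (hX : (χ P).idx.XSites ⊆ (χ P).idx.boxT 2)
    (hB : 1 ≤ (χ P).toResid.consts.B₃) (hY : 1 ≤ (χ P).toResid.consts.B₃ ^ 2 * (χ P).toResid.consts.O₁ * (χ P).toResid.consts.M)
    (hα₁ : 16 * ((χ P).toResid.consts.O₁ * (χ P).toResid.consts.M * (χ P).toResid.consts.α₁) ≤ (χ P).toResid.consts.β)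
    (hL10 : 1 + 10 * (χ P).toResid.consts.β ≤ (χ P).toResid.consts.L ^ 2) (hB'' : 0 ≤ (χ P).toResid.B₃'')
    (hres'' : (χ P).toResid.B₃'' * (χ P).toResid.consts.α₃ ≤ (χ P).toResid.consts.β * (χ P).toResid.consts.L⁻¹ ^ 2 * (χ P).toResid.consts.α₀)
    (hresJ : 4 * (((F.P P.K).d - 1) * ((2 : ℝ) * B12Eq311CurrentExpansion.C311 1)) *
      ((χ P).toResid.consts.B₃ ^ 2 * (χ P).toResid.consts.O₁ * (χ P).toResid.consts.M) ^ 2 * (χ P).toResid.consts.α₀ ≤ (χ P).toResid.consts.β)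
    (inputsRef : ∀ (Φ : FieldPair (F.P P.K) 0 (MatA N)ˣ (MatA N)) (A : PBond (F.P P.K) 0 → MatA N) (τ : ℝ) (B' : PBond (F.P P.K) 0 → MatA N),
      Φ ∈ space (suModel N) ((χ P).toResid.frameBox (θ.Rz P.K)) ((χ P).toResid.csBox θ.s2.cB)
          ((1 + 2 * (χ P).toResid.consts.β) * (χ P).toResid.consts.α₀) ((1 + 2 * (χ P).toResid.consts.β) * (χ P).toResid.consts.α₁) (χ P).toResid.α₀ →
        A ∈ (χ P).toResid.A331 → 0 ≤ τ → τ ≤ 1 → ‖B'‖ < (χ P).toResid.consts.α₃ →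
          JInputsRef (suModel N) (χ P).toResid.consts ((χ P).toResid.frameX (θ.Rz P.K)) ((χ P).toResid.frameBox (θ.Rz P.K))
            ((χ P).toResid.csX θ.s2.cB) ((χ P).toResid.csBox θ.s2.cB) (χ P).toResid.regionY (B12Lemma4Models.slProj N) (χ P).toResid.idx.η
            (χ P).toResid.B₃'' (χ P).toResid.α₀ (χ P).toResid.idx.j τ ‖B'‖ ((χ P).K Φ A τ) ((χ P).A₂ Φ A τ B') ((χ P).H Φ A) ((χ P).H₁ Φ A))
    (hWa : AnalyticOnNhd ℂ (χ P).W {Y : 𝒴 P | ‖Y‖ < (χ P).a₃}) (hTa : AnalyticOnNhd ℂ (χ P).T {Y : 𝒴 P | ‖Y‖ < (χ P).ε₄ + (χ P).a})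
    (hBan : ∀ {E : Type} [NormedAddCommGroup E] [NormedSpace ℂ E] {Φf : E → FieldPair (F.P P.K) 0 (MatA N)ˣ (MatA N)}
      {Af Bf : E → PBond (F.P P.K) 0 → MatA N} {e₀ : E}, LettersAnalyticAt Φf Af Bf e₀ →
        Φf e₀ ∈ space (suModel N) ((χ P).toResid.frameBox (θ.Rz P.K)) ((χ P).toResid.csBox θ.s2.cB)
            ((1 + 2 * (χ P).toResid.consts.β) * (χ P).toResid.consts.α₀) ((1 + 2 * (χ P).toResid.consts.β) * (χ P).toResid.consts.α₁) (χ P).toResid.α₀ →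
          Af e₀ ∈ (χ P).toResid.A331 → AnalyticAt ℂ (fun e => (χ P).fldB (Φf e) (Af e)) e₀) :
    B12Sec2to5.Lemma4Printed (F12OfRecord₁₂ F N θ (fun q => (χ q).toResid) P) ((fun q => (χ q).toResid) P).consts :=
  leaf_of_chart_of_analytic laws hX hB hY hα₁ hL10 hB'' hres'' hresJ inputsRef hWa hTa hBan hθ.pos.1

end Stage12

end Summit.QuantumFields.YangMills.BalabanUVNodes.N09ChartLettersAnalytic

end
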